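import Summits.HodgeConjecture.CorCM.AbelianSixteenSimpleEightfoldsExist
import Summits.HodgeConjecture.CorCM.AbelianTwoPowerCMTypesWeilType
import HarnessLib

/-!
# Subgroup induction: a primitive balanced CM set on a subgroup through complex conjugation induces a PRIMITIVE
# DEGENERATE CM type

COR-CM (cell `pub-hodgecm2`), binder seat b04 (gen 16), count-neutral claim ABELIAN-2POWER-NECESSITY, part I.
KERNEL ONLY: theorems; no definition, no named fact, no `sorry`.  `HC_CM` is neither used nor claimed.

Why a new device is needed.  Parts V/VI of gen 15 (`AbelianSixteen.exists_isPrimitive_of_galoisModel`,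
`…_not_isNondegenerate_of_balancedModel`) turn a kernel-decided model on a group `M` ISOMORPHIC to `Gal(K/ℚ)` into a
primitive (degenerate) CM type of `K`; that settles one Galois type at a time.  To reach ALL abelian CM fields of
`2`-power degree one must pass from a small group to every group containing it.  INFLATION from a quotient
`Gal(K/ℚ) ↠ Gal(K₀/ℚ)` (types induced from a CM subfield `K₀`) preserves degeneracy but DESTROYS primitivity (the
inflated type is stabilised by `Gal(K/K₀)`).  INDUCTION from a SUBGROUP `G' ∋ c` keeps both:

* §1 **`exists_finset_of_subgroupModel`** (any finite commutative group `G`, `j : M ↪ G` additive-to-multiplicative,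
  `c = j(c₀)`): given `T₀ ⊆ M` (CM set for `c₀`, trivial stabiliser, balanced over the fibres of `f : M → N`) and a
  companion `T₁ ⊆ M` (CM set, balanced, and `T₀` is NOT a translate of `T₁`), the set
  `T = T₀ on G' = j(M)`, `T = t·j(T₁)` on every other coset `t G'` (fixed representatives `t`) is a CM set for `c`
  in `G` with TRIVIAL stabiliser (an `s ∉ G'` stabilising `T` would make `T₀` a translate of `T₁`; an `s ∈ G' ∖ 1`
  is excluded by the primitivity of `T₀`), balanced over the cosets of `H = j(ker f)`.
* §2 **`exists_isPrimitive_not_isNondegenerate_of_galoisFinset`** (`K/ℚ` Galois CM with commutative Galois group):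
  a CM set `T ⊆ Gal(K/ℚ)` with trivial stabiliser, balanced over the cosets of a subgroup `H ∌ c`, gives the
  PRIMITIVE CM type `Φ = {σ_g : g ∈ T}` balanced over the fixed field `K^H` (a subfield with a complex place), hence
  DEGENERATE (Yanai's `a = b`, tree `Pohlmann1968.not_isNondegenerate_of_fibres_balanced`) — the `e`-free form of
  gen 15's dictionary.
* §3 **`exists_isPrimitive_not_isNondegenerate_of_subgroupModel`**: §1 + §2; and the realisation form
  **`exists_simple_degenerate_of_subgroupModel`** (a simple CM abelian variety of dimension `[K:ℚ]/2` with an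
  exceptional Hodge class on some power; Shimura's existence theorem = tree `cmAbelianVarietyRealised_holds`).

Parts II–IV supply the six kernel-decided ATOMS (orders `16`, `32`), the ATOM-EMBEDDING theorem for abelian
`2`-groups, and the classification of the abelian CM fields of `2`-power degree all of whose simple CM abelian
varieties are nondegenerate.

## References

* [Shimura1998] G. Shimura, *Abelian Varieties with Complex Multiplication and Modular Functions*, §6.2 Thm. 3,
  §8.1, §8.2 Prop. 26, §18.2 Lemma.
* [Gordon1999HodgeAVSurvey] B. B. Gordon, *A survey of the Hodge conjecture for abelian varieties*, §9.4.3
  (Theorem [B.140] = Yanai 1994), Thm. 6.4.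
* [Dodson1984] B. Dodson, *The structure of Galois groups of CM-fields*, Trans. AMS 283 (1984), §3.2.1 (primitive
  degenerate types on `⟨ρ⟩ × ℤ_n`; the present induction device is not there).
-/

noncomputable section

open CategoryTheory CategoryTheory.Limits NumberField

namespace Summit.HodgeConjecture.CorCM.SubgroupInduction

open Literature.NumberTheory.ComplexMultiplication
open Literature.AlgebraicGeometry.Motives (AbelianVariety CMType)
open Literature.AlgebraicGeometry.HodgeTheory
open Literature.AlgebraicGeometry.ComplexMultiplication (IsCMTypeRealisation isSimple_iff_isPrimitive)
open Literature.AlgebraicGeometry.Pohlmann1968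
open Literature.Barriers.HodgeConjecture (divisorClassesSpan)
open Summit.HodgeConjecture.CorCM.GaloisOctic (embOf_complexConj_mul exists_embOf_comp_algebraMap_eq)
open Summit.HodgeConjecture.CorCM.AbelianTwoPower (embOf_comp_eq_iff)
open Summit.HodgeConjecture.CorCM.AbelianSixteen (exists_simple_realisation_of_isPrimitive)

open scoped Classical

/-! ## §1 The group-level induction -/

section Group

variable {G : Type*} [CommGroup G] [Fintype G]
variable {M N : Type*} [AddCommGroup M] [Fintype M] [AddCommGroup N]

/-- **SUBGROUP INDUCTION (group level).**  Let `j : M → G` be an injective homomorphism (written additively on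
`M`, multiplicatively on the finite commutative group `G`), `c = j(c₀)`, `T₀, T₁ ⊆ M` CM sets for `c₀`
(`x ∈ Tᵢ ↔ c₀ + x ∉ Tᵢ`), `T₀` with trivial stabiliser, `T₀` not a translate of `T₁`, both balanced over the fibres
of `f : M → N`.  Then there is a CM set `T ⊆ G` for `c` with TRIVIAL stabiliser, balanced over the cosets of
`H = j(ker f)`: `T ∩ j(M) = j(T₀)` and `T ∩ t·j(M) = t·j(T₁)` on the other cosets. [folklore] -/
theorem exists_finset_of_subgroupModel (j : M →+ Additive G) (hj : Function.Injective j) (c₀ : M)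
    (T₀ T₁ : Finset M) (hcm₀ : ∀ x : M, x ∈ T₀ ↔ c₀ + x ∉ T₀) (hcm₁ : ∀ x : M, x ∈ T₁ ↔ c₀ + x ∉ T₁)
    (hprim : ∀ v : M, v ≠ 0 → ∃ w : M, ¬ (w ∈ T₀ ↔ v + w ∈ T₀))
    (hntr : ∀ d : M, ∃ w : M, ¬ (w ∈ T₁ ↔ d + w ∈ T₀)) (f : M →+ N)
    (hbal₀ : ∀ x : M, (Finset.univ.filter fun h : M => f h = f x ∧ h ∈ T₀).card =
      (Finset.univ.filter fun h : M => f h = f x ∧ h ∉ T₀).card)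
    (hbal₁ : ∀ x : M, (Finset.univ.filter fun h : M => f h = f x ∧ h ∈ T₁).card =
      (Finset.univ.filter fun h : M => f h = f x ∧ h ∉ T₁).card) :
    ∃ (T : Finset G) (H : Subgroup G), (∀ g : G, g ∈ H ↔ ∃ m : M, f m = 0 ∧ Additive.toMul (j m) = g) ∧
      (∀ g : G, g ∈ T ↔ Additive.toMul (j c₀) * g ∉ T) ∧
      (∀ v : G, v ≠ 1 → ∃ w : G, ¬ (w ∈ T ↔ v * w ∈ T)) ∧
      ∀ g₀ : G, {g : G | g₀ * g⁻¹ ∈ H ∧ g ∈ T}.ncard = {g : G | g₀ * g⁻¹ ∈ H ∧ g ∉ T}.ncard := by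
  -- the embedding `ι = j` read multiplicatively
  set ι : M → G := fun m => Additive.toMul (j m) with hι
  have hιadd : ∀ a b : M, ι (a + b) = ι a * ι b := fun a b => by simp only [hι, map_add, toMul_add]
  have hιzero : ι 0 = 1 := by simp only [hι, map_zero, toMul_zero]
  have hιneg : ∀ a : M, ι (-a) = (ι a)⁻¹ := fun a => by simp only [hι, map_neg, toMul_neg]
  have hιsub : ∀ a b : M, ι (a - b) = ι a * (ι b)⁻¹ := fun a b => by rw [sub_eq_add_neg, hιadd, hιneg]
  have hιinj : Function.Injective ι := fun a b h => hj (Additive.toMul.injective h)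
  -- the subgroup `G' = ι(M)`
  obtain ⟨G', hG'⟩ : ∃ G' : Subgroup G, ∀ g, g ∈ G' ↔ ∃ m, ι m = g :=
    ⟨{ carrier := {g | ∃ m, ι m = g}
       mul_mem' := by
         rintro a b ⟨m, rfl⟩ ⟨m', rfl⟩
         exact ⟨m + m', hιadd m m'⟩
       one_mem' := ⟨0, hιzero⟩
       inv_mem' := by
         rintro a ⟨m, rfl⟩
         exact ⟨-m, hιneg m⟩ }, fun _ => Iff.rfl⟩
  have hιmem : ∀ m, ι m ∈ G' := fun m => (hG' _).2 ⟨m, rfl⟩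
  -- coset representatives, `rep 1 = 1`
  set rep : G ⧸ G' → G := fun q => if q = 1 then 1 else Quotient.out q with hrep_def
  have hrep : ∀ q : G ⧸ G', ((rep q : G) : G ⧸ G') = q := by
    intro q
    by_cases hq : q = 1
    · rw [hrep_def]; simp only [hq, if_true, QuotientGroup.mk_one]
    · rw [hrep_def]; simp only [hq, if_false]; exact QuotientGroup.out_eq' q
  have hrep1 : rep 1 = 1 := by rw [hrep_def]; simp only [if_true]
  -- the `M`-coordinate `μ g` of `g = rep(gG') · ι(μ g)`
  have hex : ∀ g : G, ∃ m : M, ι m = (rep (g : G ⧸ G'))⁻¹ * g := by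
    intro g
    rw [← hG']
    exact QuotientGroup.eq.1 (hrep (g : G ⧸ G'))
  choose μ hμ using hex
  have hnf : ∀ g : G, g = rep (g : G ⧸ G') * ι (μ g) := fun g => by
    rw [hμ g, mul_inv_cancel_left]
  -- the normal form `rep q * ι x`
  have hcoset : ∀ (q : G ⧸ G') (x : M), ((rep q * ι x : G) : G ⧸ G') = q := by
    intro q x
    rw [← hrep q]
    refine (QuotientGroup.eq.2 ?_).symm
    rw [hrep q, inv_mul_cancel_left]
    exact hιmem x
  have hμnf : ∀ (q : G ⧸ G') (x : M), μ (rep q * ι x) = x := by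
    intro q x
    apply hιinj
    rw [hμ, hcoset, inv_mul_cancel_left]
  -- the pattern: `T₀` on the coset `G'`, `T₁` elsewhere
  set S : G ⧸ G' → Finset M := fun q => if q = 1 then T₀ else T₁ with hS_def
  have hS1 : S 1 = T₀ := by rw [hS_def]; simp only [if_true]
  have hSne : ∀ q, q ≠ 1 → S q = T₁ := fun q hq => by rw [hS_def]; simp only [hq, if_false]
  have hcmS : ∀ q x, x ∈ S q ↔ c₀ + x ∉ S q := by
    intro q x
    by_cases hq : q = 1
    · rw [hq, hS1]; exact hcm₀ x
    · rw [hSne q hq]; exact hcm₁ x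
  have hbalS : ∀ q x, (Finset.univ.filter fun h : M => f h = f x ∧ h ∈ S q).card =
      (Finset.univ.filter fun h : M => f h = f x ∧ h ∉ S q).card := by
    intro q x
    by_cases hq : q = 1
    · rw [hq, hS1]; exact hbal₀ x
    · rw [hSne q hq]; exact hbal₁ x
  set T : Finset G := Finset.univ.filter fun g : G => μ g ∈ S (g : G ⧸ G') with hT_def
  have hmemT : ∀ g : G, g ∈ T ↔ μ g ∈ S (g : G ⧸ G') := fun g => by
    simp only [hT_def, Finset.mem_filter, Finset.mem_univ, true_and]
  have hmem_nf : ∀ (q : G ⧸ G') (x : M), rep q * ι x ∈ T ↔ x ∈ S q := by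
    intro q x
    rw [hmemT, hμnf, hcoset]
  -- the subgroup `H = ι(ker f)`
  obtain ⟨H, hH⟩ : ∃ H : Subgroup G, ∀ g, g ∈ H ↔ ∃ m, f m = 0 ∧ ι m = g :=
    ⟨{ carrier := {g | ∃ m, f m = 0 ∧ ι m = g}
       mul_mem' := by
         rintro a b ⟨m, hm, rfl⟩ ⟨m', hm', rfl⟩
         exact ⟨m + m', by rw [map_add, hm, hm', add_zero], hιadd m m'⟩
       one_mem' := ⟨0, map_zero f, hιzero⟩
       inv_mem' := by
         rintro a ⟨m, hm, rfl⟩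
         exact ⟨-m, by rw [map_neg, hm, neg_zero], hιneg m⟩ }, fun _ => Iff.rfl⟩
  refine ⟨T, H, hH, fun g => ?_, fun v hv => ?_, fun g₀ => ?_⟩
  · -- CM set for `c = ι c₀`
    set q := (g : G ⧸ G')
    have hg := hnf g
    have hcg : Additive.toMul (j c₀) * g = rep q * ι (c₀ + μ g) := by
      change ι c₀ * g = _
      conv_lhs => rw [hg]
      rw [hιadd, mul_left_comm]
    rw [hcg, hmem_nf, hmemT]
    exact hcmS q (μ g)
  · -- trivial stabiliser
    by_cases hvG : v ∈ G'
    · obtain ⟨v₀, rfl⟩ := (hG' v).1 hvG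
      have hv₀ : v₀ ≠ 0 := fun h => hv (by rw [h, hιzero])
      obtain ⟨w₀, hw₀⟩ := hprim v₀ hv₀
      refine ⟨ι w₀, fun h => hw₀ ?_⟩
      have h1 : ι w₀ = rep 1 * ι w₀ := by rw [hrep1, one_mul]
      have h2 : ι v₀ * ι w₀ = rep 1 * ι (v₀ + w₀) := by rw [hrep1, one_mul, hιadd]
      rw [h2] at h
      rw [h1, hmem_nf, hmem_nf, hS1] at h
      exact h
    · set q₁ := ((v⁻¹ : G) : G ⧸ G') with hq₁_def
      have hq₁ : q₁ ≠ 1 := fun h => hvG (by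
        rw [hq₁_def, QuotientGroup.eq_one_iff] at h
        exact (Subgroup.inv_mem_iff G').1 h)
      have hvt : v * rep q₁ ∈ G' := by
        have h := QuotientGroup.eq.1 (hrep q₁).symm
        rwa [inv_inv] at h
      obtain ⟨d, hd⟩ := (hG' _).1 hvt
      obtain ⟨w₀, hw₀⟩ := hntr d
      refine ⟨rep q₁ * ι w₀, fun h => hw₀ ?_⟩
      have h2 : v * (rep q₁ * ι w₀) = rep 1 * ι (d + w₀) := by
        rw [← mul_assoc, ← hd, hrep1, one_mul, hιadd]
      rw [h2, hmem_nf, hmem_nf, hS1, hSne q₁ hq₁] at h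
      exact h
  · -- balanced over the cosets of `H`
    set q := (g₀ : G ⧸ G')
    set x₀ := μ g₀
    have hg₀ := hnf g₀
    have hinjq : Function.Injective fun y : M => rep q * ι y := fun a b h =>
      hιinj (mul_left_cancel h)
    have hdiv : ∀ a b : M, rep q * ι a * (rep q * ι b)⁻¹ = ι (a - b) := fun a b => by
      rw [← div_eq_mul_inv, mul_div_mul_left_eq_div, div_eq_mul_inv, ← hιsub]
    have hfib : ∀ p : Prop, {g : G | g₀ * g⁻¹ ∈ H ∧ (g ∈ T ↔ p)} =
        (fun y : M => rep q * ι y) '' {y : M | f y = f x₀ ∧ (y ∈ S q ↔ p)} := by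
      intro p
      ext g
      simp only [Set.mem_setOf_eq, Set.mem_image]
      constructor
      · rintro ⟨hgH, hp⟩
        obtain ⟨m, hm0, hm⟩ := (hH _).1 hgH
        have hg : g = rep q * ι (x₀ - m) := by
          have h1 : g = (ι m)⁻¹ * g₀ := by rw [hm, mul_inv_rev, inv_inv, inv_mul_cancel_right]
          rw [h1, hg₀, hιsub, mul_left_comm, mul_comm ((ι m)⁻¹)]
        refine ⟨x₀ - m, ⟨by rw [map_sub, hm0, sub_zero], ?_⟩, hg.symm⟩
        rw [hg, hmem_nf] at hp
        exact hp
      · rintro ⟨y, ⟨hy, hp⟩, rfl⟩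
        refine ⟨(hH _).2 ⟨x₀ - y, by rw [map_sub, hy, sub_self], ?_⟩, by rw [hmem_nf]; exact hp⟩
        rw [hg₀, hdiv]
    have hcnt : ∀ p : Prop, {g : G | g₀ * g⁻¹ ∈ H ∧ (g ∈ T ↔ p)}.ncard =
        (Finset.univ.filter fun y : M => f y = f x₀ ∧ (y ∈ S q ↔ p)).card := by
      intro p
      rw [hfib, Set.ncard_image_of_injective _ hinjq, ← Set.ncard_coe_finset]
      congr 1
      ext y
      simp only [Set.mem_setOf_eq, Finset.coe_filter, Finset.mem_univ, true_and]
    rw [show {g : G | g₀ * g⁻¹ ∈ H ∧ g ∈ T} = {g : G | g₀ * g⁻¹ ∈ H ∧ (g ∈ T ↔ True)} by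
        simp only [iff_true],
      show {g : G | g₀ * g⁻¹ ∈ H ∧ g ∉ T} = {g : G | g₀ * g⁻¹ ∈ H ∧ (g ∈ T ↔ False)} by
        simp only [iff_false],
      hcnt, hcnt]
    convert hbalS q x₀ using 3 <;> simp only [iff_true, iff_false]

end Group

/-! ## §2 Galois CM fields: a CM set on the Galois group with trivial stabiliser, balanced over a subgroup
avoiding complex conjugation, is a primitive degenerate CM type -/

section Field

variable {K : Type} [Field K] [NumberField K] [IsCMField K]

/-- **CM sets on `Gal(K/ℚ)` ⟹ CM types** (`K/ℚ` Galois CM; no isomorphism with a model group needed).  Let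
`T ⊆ Gal(K/ℚ)` satisfy `g ∈ T ↔ cg ∉ T` (CM set for complex conjugation `c`) and have trivial left stabiliser, and
let `H ≤ Gal(K/ℚ)` be a subgroup NOT containing `c` such that every coset of `H` meets `T` in exactly half of its
points.  Then `Φ = {σ_g : g ∈ T}` (`σ_g = φ₀ ∘ g⁻¹`) is a PRIMITIVE CM type of `K` (the `Aut(ℂ)`-translates act by
right translations on `Gal(K/ℚ)`, Shimura §8.2 Prop. 26 in the form `isPrimitive_iff_forall_eq`), balanced over the
fixed field `k = K^H` — a subfield with a complex place, since `c ∉ H = Gal(K/k)` — hence DEGENERATE by Yanai's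
theorem, case `a = b` (`Pohlmann1968.not_isNondegenerate_of_fibres_balanced`).
[cite: Gordon1999HodgeAVSurvey, §9.4.3 (Theorem [B.140])] [cite: Shimura1998, §8.1, §8.2 Prop. 26] -/
theorem exists_isPrimitive_not_isNondegenerate_of_galoisFinset [IsGalois ℚ K] (T : Finset (K ≃ₐ[ℚ] K))
    (hcm : ∀ g : K ≃ₐ[ℚ] K, g ∈ T ↔ (IsCMField.complexConj K).restrictScalars ℚ * g ∉ T)
    (hprim : ∀ v : K ≃ₐ[ℚ] K, v ≠ 1 → ∃ w : K ≃ₐ[ℚ] K, ¬ (w ∈ T ↔ v * w ∈ T))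
    (H : Subgroup (K ≃ₐ[ℚ] K)) (hcH : (IsCMField.complexConj K).restrictScalars ℚ ∉ H)
    (hbal : ∀ g₀ : K ≃ₐ[ℚ] K, {g : K ≃ₐ[ℚ] K | g₀ * g⁻¹ ∈ H ∧ g ∈ T}.ncard =
      {g : K ≃ₐ[ℚ] K | g₀ * g⁻¹ ∈ H ∧ g ∉ T}.ncard) (φ₀ : K →+* ℂ) :
    ∃ Φ : CMType K, IsPrimitive (ℂ ≃+* ℂ) Φ.1 φ₀ ∧ ¬ IsNondegenerate Φ ∧
      ∀ g : K ≃ₐ[ℚ] K, embOf φ₀ g ∈ Φ.1 ↔ g ∈ T := by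
  haveI := isPretransitive_ringEquiv_complex (K := K)
  set c : K ≃ₐ[ℚ] K := (IsCMField.complexConj K).restrictScalars ℚ with hc_def
  have hEinj : Function.Injective (embOf φ₀) := (embOf_bijective φ₀).1
  have hEsurj : Function.Surjective (embOf φ₀) := (embOf_bijective φ₀).2
  -- the CM type `Φ = σ(T)`
  set S : Set (K →+* ℂ) := embOf φ₀ '' (T : Set (K ≃ₐ[ℚ] K)) with hS_def
  have hmemE : ∀ g, embOf φ₀ g ∈ S ↔ g ∈ T := fun g => by
    rw [hS_def, hEinj.mem_set_image, Finset.mem_coe]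
  have hcm' : ∀ φ, φ ∈ S ↔ ComplexEmbedding.conjugate φ ∉ S := by
    intro φ
    obtain ⟨g, rfl⟩ := hEsurj φ
    rw [← embOf_complexConj_mul, hmemE, hmemE]
    exact hcm g
  let Φ : CMType K := ⟨S, hcm'⟩
  refine ⟨Φ, ?_, ?_, fun g => hmemE g⟩
  · -- primitive: the translates separate the embeddings
    rw [isPrimitive_iff_forall_eq]
    intro φ₁ φ₂ hsep
    obtain ⟨g₁, rfl⟩ := hEsurj φ₁
    obtain ⟨g₂, rfl⟩ := hEsurj φ₂
    by_contra hne
    have hv : g₂ * g₁⁻¹ ≠ 1 := fun h => hne (by rw [mul_inv_eq_one] at h; rw [h])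
    obtain ⟨w, hw⟩ := hprim _ hv
    obtain ⟨τ, hτ⟩ := exists_ringEquiv_comp_eq_algEquiv φ₀ (w⁻¹ * g₁)
    have h := hsep τ
    have h1 : g₁ * (w⁻¹ * g₁)⁻¹ = w := by rw [mul_inv_rev, inv_inv, mul_inv_cancel_left]
    have h2 : g₂ * (w⁻¹ * g₁)⁻¹ = g₂ * g₁⁻¹ * w := by rw [mul_inv_rev, inv_inv, mul_assoc]
    rw [smul_embOf_of_comp φ₀ hτ, smul_embOf_of_comp φ₀ hτ, h1, h2] at h
    exact hw ((hmemE w).symm.trans (h.trans (hmemE _)))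
  · -- degenerate: balanced over the fixed field of `H`, which has a complex place
    set k : IntermediateField ℚ K := IntermediateField.fixedField H with hk
    set jk : k →+* K := algebraMap k K with hjk
    have hres : ∀ g g' : K ≃ₐ[ℚ] K, (embOf φ₀ g).comp jk = (embOf φ₀ g').comp jk ↔ g' * g⁻¹ ∈ H :=
      fun g g' => by rw [hjk, hk]; exact embOf_comp_eq_iff φ₀ H g g'
    have hk_cx : ComplexEmbedding.conjugate ((embOf φ₀ 1).comp jk) ≠ (embOf φ₀ 1).comp jk := by
      intro h
      have h' : (embOf φ₀ (c * 1)).comp jk = (embOf φ₀ 1).comp jk := by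
        rw [embOf_complexConj_mul]; exact h
      rw [hres, mul_one, one_mul, inv_mem_iff] at h'
      exact hcH h'
    have hW : ∀ τ : k →+* ℂ, {φ : K →+* ℂ | φ.comp jk = τ ∧ φ ∈ S}.ncard =
        {φ : K →+* ℂ | φ.comp jk = τ ∧ φ ∉ S}.ncard := by
      intro τ
      obtain ⟨g₀, hg₀⟩ := exists_embOf_comp_algebraMap_eq φ₀ k τ
      have hfib : ∀ P : (K →+* ℂ) → Prop, {φ : K →+* ℂ | φ.comp jk = τ ∧ P φ} =
          embOf φ₀ '' {g : K ≃ₐ[ℚ] K | g₀ * g⁻¹ ∈ H ∧ P (embOf φ₀ g)} := by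
        intro P
        ext φ
        simp only [Set.mem_setOf_eq, Set.mem_image]
        constructor
        · rintro ⟨hφ, hP⟩
          obtain ⟨g, rfl⟩ := hEsurj φ
          exact ⟨g, ⟨(hres g g₀).1 (hφ.trans hg₀.symm), hP⟩, rfl⟩
        · rintro ⟨g, ⟨hg, hP⟩, rfl⟩
          exact ⟨((hres g g₀).2 hg).trans hg₀, hP⟩
      rw [hfib (fun φ => φ ∈ S), hfib (fun φ => φ ∉ S), Set.ncard_image_of_injective _ hEinj,
        Set.ncard_image_of_injective _ hEinj]
      convert hbal g₀ using 3 <;> simp only [hmemE]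
    exact not_isNondegenerate_of_fibres_balanced jk hW hk_cx

/-! ## §3 Subgroup models on the Galois group -/

/-- **SUBGROUP INDUCTION (field level).**  `K/ℚ` Galois CM with ABELIAN Galois group; `j : M ↪ Gal(K/ℚ)` an
injective homomorphism from an additive group with `j(c₀) = c` (complex conjugation); `T₀ ⊆ M` a CM set for `c₀`
with trivial stabiliser, balanced over the fibres of `f : M → N` with `f(c₀) ≠ 0`; `T₁ ⊆ M` a balanced CM set of
which `T₀` is not a translate.  Then `K` has a PRIMITIVE DEGENERATE CM type (of Weil type over the fixed field of
`j(ker f)`).  Inflating from a CM SUBFIELD would lose primitivity; inducing from the SUBGROUP `j(M) ∋ c` (any index)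
does not. [cite: Gordon1999HodgeAVSurvey, §9.4.3 (Theorem [B.140])] [cite: Shimura1998, §8.1, §8.2 Prop. 26] -/
theorem exists_isPrimitive_not_isNondegenerate_of_subgroupModel [IsGalois ℚ K]
    (hcomm : ∀ g h : K ≃ₐ[ℚ] K, g * h = h * g) {M N : Type*} [AddCommGroup M] [Fintype M] [AddCommGroup N]
    (j : M →+ Additive (K ≃ₐ[ℚ] K)) (hj : Function.Injective j) (c₀ : M)
    (hc : Additive.toMul (j c₀) = (IsCMField.complexConj K).restrictScalars ℚ) (T₀ T₁ : Finset M)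
    (hcm₀ : ∀ x : M, x ∈ T₀ ↔ c₀ + x ∉ T₀) (hcm₁ : ∀ x : M, x ∈ T₁ ↔ c₀ + x ∉ T₁)
    (hprim : ∀ v : M, v ≠ 0 → ∃ w : M, ¬ (w ∈ T₀ ↔ v + w ∈ T₀))
    (hntr : ∀ d : M, ∃ w : M, ¬ (w ∈ T₁ ↔ d + w ∈ T₀)) (f : M →+ N) (hfc : f c₀ ≠ 0)
    (hbal₀ : ∀ x : M, (Finset.univ.filter fun h : M => f h = f x ∧ h ∈ T₀).card =
      (Finset.univ.filter fun h : M => f h = f x ∧ h ∉ T₀).card)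
    (hbal₁ : ∀ x : M, (Finset.univ.filter fun h : M => f h = f x ∧ h ∈ T₁).card =
      (Finset.univ.filter fun h : M => f h = f x ∧ h ∉ T₁).card) (φ₀ : K →+* ℂ) :
    ∃ Φ : CMType K, IsPrimitive (ℂ ≃+* ℂ) Φ.1 φ₀ ∧ ¬ IsNondegenerate Φ := by
  letI : CommGroup (K ≃ₐ[ℚ] K) := { (inferInstance : Group (K ≃ₐ[ℚ] K)) with mul_comm := hcomm }
  obtain ⟨T, H, hH, hcmT, hprimT, hbalT⟩ :=
    exists_finset_of_subgroupModel j hj c₀ T₀ T₁ hcm₀ hcm₁ hprim hntr f hbal₀ hbal₁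
  have hcH : (IsCMField.complexConj K).restrictScalars ℚ ∉ H := by
    rw [hH]
    rintro ⟨m, hm0, hm⟩
    rw [← hc] at hm
    have : m = c₀ := hj (Additive.toMul.injective hm)
    rw [this] at hm0
    exact hfc hm0
  rw [hc] at hcmT
  obtain ⟨Φ, hΦprim, hΦdeg, -⟩ :=
    exists_isPrimitive_not_isNondegenerate_of_galoisFinset T hcmT hprimT H hcH hbalT φ₀
  exact ⟨Φ, hΦprim, hΦdeg⟩

/-- **Realisation form**: under the hypotheses of `exists_isPrimitive_not_isNondegenerate_of_subgroupModel` there is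
a SIMPLE abelian variety of dimension `[K:ℚ]/2` with complex multiplication by `K` (Shimura's existence theorem, tree
`cmAbelianVarietyRealised_holds`; simple ⟺ primitive, Shimura §8.2 Prop. 26) whose CM type is DEGENERATE, carrying an
exceptional Hodge class — rational, of type `(m,m)`, outside the complexified divisor ring — on some power
(Hazama/Pohlmann, tree `exists_exceptional_pow_of_not_isNondegenerate`). [cite: Shimura1998, §6.2 Thm. 3 and §8.2
Prop. 26] [cite: Gordon1999HodgeAVSurvey, Thm. 6.4 and §9.4.3] -/
theorem exists_simple_degenerate_of_subgroupModel [IsGalois ℚ K]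
    (hcomm : ∀ g h : K ≃ₐ[ℚ] K, g * h = h * g) {M N : Type*} [AddCommGroup M] [Fintype M] [AddCommGroup N]
    (j : M →+ Additive (K ≃ₐ[ℚ] K)) (hj : Function.Injective j) (c₀ : M)
    (hc : Additive.toMul (j c₀) = (IsCMField.complexConj K).restrictScalars ℚ) (T₀ T₁ : Finset M)
    (hcm₀ : ∀ x : M, x ∈ T₀ ↔ c₀ + x ∉ T₀) (hcm₁ : ∀ x : M, x ∈ T₁ ↔ c₀ + x ∉ T₁)
    (hprim : ∀ v : M, v ≠ 0 → ∃ w : M, ¬ (w ∈ T₀ ↔ v + w ∈ T₀))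
    (hntr : ∀ d : M, ∃ w : M, ¬ (w ∈ T₁ ↔ d + w ∈ T₀)) (f : M →+ N) (hfc : f c₀ ≠ 0)
    (hbal₀ : ∀ x : M, (Finset.univ.filter fun h : M => f h = f x ∧ h ∈ T₀).card =
      (Finset.univ.filter fun h : M => f h = f x ∧ h ∉ T₀).card)
    (hbal₁ : ∀ x : M, (Finset.univ.filter fun h : M => f h = f x ∧ h ∈ T₁).card =
      (Finset.univ.filter fun h : M => f h = f x ∧ h ∉ T₁).card) :
    ∃ (Φ : CMType K) (φ₀ : K →+* ℂ) (A : AbelianVariety ℂ) (ι : 𝓞 K →+* End A)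
      (θ : K →+* Module.End ℂ (complexBetti A.X 1)),
      IsPrimitive (ℂ ≃+* ℂ) Φ.1 φ₀ ∧ ¬ IsNondegenerate Φ ∧ IsCMTypeRealisation Φ A ι θ ∧ A.IsSimple ∧
      A.dim = Module.finrank ℚ K / 2 ∧
      ∃ n m : ℕ, ∃ x : complexBetti (⨁ fun _ : Fin n => A).X (2 * m), IsRationalClass x ∧
        IsOfHodgeType (⨁ fun _ : Fin n => A).dim (⨁ fun _ : Fin n => A).X (2 * m) m m x ∧
        x ∉ divisorClassesSpan (⨁ fun _ : Fin n => A).X (⨁ fun _ : Fin n => A).dim m := by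
  obtain ⟨φ₀⟩ := (inferInstance : Nonempty (K →+* ℂ))
  obtain ⟨Φ, hprimΦ, hdeg⟩ := exists_isPrimitive_not_isNondegenerate_of_subgroupModel hcomm j hj c₀ hc T₀ T₁
    hcm₀ hcm₁ hprim hntr f hfc hbal₀ hbal₁ φ₀
  obtain ⟨A, ι, θ, hA, hs, hdim⟩ := exists_simple_realisation_of_isPrimitive Φ φ₀ hprimΦ
  exact ⟨Φ, φ₀, A, ι, θ, hprimΦ, hdeg, hA, hs, hdim,
    exists_exceptional_pow_of_not_isNondegenerate φ₀ hprimΦ hdeg hA⟩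

end Field


end Summit.HodgeConjecture.CorCM.SubgroupInduction

end
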